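import Summits.CriticalPhenomena.PercolationContinuityZ3.Theorems.PercNearOneGluingNoHeavyLowerTailKnQuestion8PocketBase
import HarnessLib

/-!
# Kozma–Nitzan's Question 8 at three relays — the proved one-frame dominations behind the (T*) / CLAIM(M) reduction

Support file (`--supports stmt-CriticalPhenomena-4575`, closed crux; independent mathematics on Kozma–Nitzan's Question 8,
arXiv:2401.12397 §5.5 p. 36), prover `prim-ineq-gen-7` (gen 12).  No definitions, no named facts, no sorries; standard axioms.
Memo `run/shared/lean/prim/prim-ineq-gen-7/FINDING-TSTAR-g12.md` §3–§4.

Frame of the five-point inequality (PS5) (memo FINDING-PEELD-g11 §6(b)): owner `x`, observers `o` and `v`, avoided set `Y`,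
`S = {x, o}`, `C_S = ⋃_{s ∈ S} C_s` the edge cluster of the SET `S`, `D = {S ↮ T}`.  By van den Berg–Häggström–Kahn's
Theorem 2.1 (`q = 1`, tree `BHK2006_twoSetConditionalAssociation`) increasing functions of `C_S` are positively associated on `D`.
This file records the denominator-free consequences used by the reduction of (PS5) to the covariance-ratio inequality CLAIM(M):
* `PocketCert.frame_event_assoc` / `frame_event_dom` — ONE application with an increasing EVENT `A` of `C_S`: for `G` monotone,
  `(∫_D G)·μ(D ∩ A) ≤ μ(D)·∫_{D∩A} G`, hence `(∫_{D∩A} G)·μ(D ∖ A) ≥ (∫_{D∖A} G)·μ(D ∩ A)` ("`law(C_S | D ∩ A) ≽ law(C_S | D ∖ A)`");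
* `PocketCert.frameDom_om_pm` — **(D2)** `law(C_S | x~o, x≁v, S↮Y) ≽ law(C_S | x≁o, o≁v, x≁v, S↮Y)`: both events lie in the frame
  `T = Y ∪ {v}`, where they are `{x ~ o}` and its complement;
* `PocketCert.frameDom_o2_p` — **(α)** `law(C_S | o ~ {x,v}, S↮Y) ≽ law(C_S | o ≁ x, o ≁ v, S↮Y)` (frame `T = Y`, event `{o~x} ∪ {o~v}`);
* `PocketCert.frameCov_ov_o2` — **(ε)** for `G ≥ 0` monotone: `(∫_{D ∩ {x~v}} G)·μ(D ∩ {o~{x,v}}) ≤ μ(D)·∫_{D ∩ {x~o~v}} G`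
  (`Cov'(G·1{x~v}, 1{o~{x,v}}) ≥ 0`; with `G = 1` the mass inequality (c4′) `ν'(x~o~v)·ν'(o≁{x,v}) ≥ ν'(o~{x,v})·ν'(x~v, o≁{x,v})`).
[cite: VandenbergHaggstromKahn2005, Thm. 2.1 (p. 9), Remark 1 after Thm. 1.2 (p. 5)] [cite: KozmaNitzan2024, Question 8 (§5.5 p. 36)]
-/

namespace Summit.CriticalPhenomena.PercolationContinuityZ3.Theorems

open MeasureTheory Set Literature.Probability.LatticeModels Literature.Probability.Percolation
open scoped Classical
open KNPreFKG

noncomputable section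

namespace PocketCert

variable {V : Type*} [Fintype V]

/-- **One vdBHK-2.1 application with an increasing event.**  `D = {S ↮ T}`, `G` monotone, `A` an increasing property of
edge sets, `E_A = {ω | A(C_S ω)}`: `(∫_D G(C_S))·μ(D ∩ E_A) ≤ μ(D)·∫_{D ∩ E_A} G(C_S)`.
[cite: VandenbergHaggstromKahn2005, Thm. 2.1 (p. 9)] -/
theorem frame_event_assoc (w : Sym2 V → unitInterval) (S T : Set V) (G : Set (Sym2 V) → ℝ) (hG : Monotone G)
    (A : Set (Sym2 V) → Prop) (hA : ∀ C C' : Set (Sym2 V), C ⊆ C' → A C → A C') :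
    (∫ ω in {ω : BondConfig V | ∀ s ∈ S, ∀ t ∈ T, ¬ (openGraph ω).Reachable s t},
        G (⋃ s ∈ S, openEdgeCluster ω s) ∂(prodBernoulli w)) *
      (prodBernoulli w).real ({ω : BondConfig V | ∀ s ∈ S, ∀ t ∈ T, ¬ (openGraph ω).Reachable s t} ∩
        {ω | A (⋃ s ∈ S, openEdgeCluster ω s)}) ≤
    (prodBernoulli w).real {ω : BondConfig V | ∀ s ∈ S, ∀ t ∈ T, ¬ (openGraph ω).Reachable s t} *
      ∫ ω in {ω : BondConfig V | ∀ s ∈ S, ∀ t ∈ T, ¬ (openGraph ω).Reachable s t} ∩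
          {ω | A (⋃ s ∈ S, openEdgeCluster ω s)}, G (⋃ s ∈ S, openEdgeCluster ω s) ∂(prodBernoulli w) := by
  classical
  set μ := prodBernoulli w with hμ
  set D : Set (BondConfig V) := {ω : BondConfig V | ∀ s ∈ S, ∀ t ∈ T, ¬ (openGraph ω).Reachable s t} with hD
  set EA : Set (BondConfig V) := {ω | A (⋃ s ∈ S, openEdgeCluster ω s)} with hEA
  have hmeas : ∀ S' : Set (BondConfig V), MeasurableSet S' := fun _ => MeasurableSet.of_discrete
  set Ae : Set (Sym2 V) → ℝ := fun C => if A C then 1 else 0 with hAe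
  have hAe_mono : Monotone Ae := by
    intro C C' hCC'
    simp only [hAe]
    by_cases h : A C
    · rw [if_pos h, if_pos (hA C C' hCC' h)]
    · rw [if_neg h]; split_ifs <;> norm_num
  have h := BHK2006_twoSetConditionalAssociation w S T (fun C _ => G C) (fun C _ => Ae C)
    (fun _ => hG) (fun _ => antitone_const) (fun _ => hAe_mono) (fun _ => antitone_const)
  have hAe_eq : ∀ ω : BondConfig V, Ae (⋃ s ∈ S, openEdgeCluster ω s) = EA.indicator (1 : BondConfig V → ℝ) ω := by
    intro ω
    simp only [hAe]
    by_cases hω : A (⋃ s ∈ S, openEdgeCluster ω s)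
    · rw [if_pos hω, indicator_of_mem (show ω ∈ EA from hω), Pi.one_apply]
    · rw [if_neg hω, indicator_of_notMem (show ω ∉ EA from hω)]
  have i1 : ∫ ω in D, Ae (⋃ s ∈ S, openEdgeCluster ω s) ∂μ = μ.real (D ∩ EA) := by
    rw [integral_congr_ae (Filter.Eventually.of_forall fun ω => hAe_eq ω)]
    exact setIntegral_indicator_one_eq μ D EA
  have hprod : ∀ ω : BondConfig V, G (⋃ s ∈ S, openEdgeCluster ω s) * Ae (⋃ s ∈ S, openEdgeCluster ω s) =
      EA.indicator (fun ω => G (⋃ s ∈ S, openEdgeCluster ω s)) ω := by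
    intro ω
    rw [hAe_eq ω]
    by_cases hω : ω ∈ EA
    · rw [indicator_of_mem hω, indicator_of_mem hω, Pi.one_apply, mul_one]
    · rw [indicator_of_notMem hω, indicator_of_notMem hω, mul_zero]
  have i2 : ∫ ω in D, G (⋃ s ∈ S, openEdgeCluster ω s) * Ae (⋃ s ∈ S, openEdgeCluster ω s) ∂μ =
      ∫ ω in D ∩ EA, G (⋃ s ∈ S, openEdgeCluster ω s) ∂μ := by
    rw [integral_congr_ae (Filter.Eventually.of_forall fun ω => hprod ω)]
    exact setIntegral_indicator (hmeas EA)
  rw [i1, i2] at h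
  exact h

/-- **Domination form.**  Same data: `(∫_{D∩E_A} G)·μ(D ∖ E_A) ≥ (∫_{D∖E_A} G)·μ(D ∩ E_A)`, i.e. `E[G | D ∩ E_A] ≥ E[G | D ∖ E_A]`
whenever both make sense. [cite: VandenbergHaggstromKahn2005, Thm. 2.1 (p. 9)] -/
theorem frame_event_dom (w : Sym2 V → unitInterval) (S T : Set V) (G : Set (Sym2 V) → ℝ) (hG : Monotone G)
    (A : Set (Sym2 V) → Prop) (hA : ∀ C C' : Set (Sym2 V), C ⊆ C' → A C → A C') :
    (∫ ω in {ω : BondConfig V | ∀ s ∈ S, ∀ t ∈ T, ¬ (openGraph ω).Reachable s t} \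
          {ω | A (⋃ s ∈ S, openEdgeCluster ω s)}, G (⋃ s ∈ S, openEdgeCluster ω s) ∂(prodBernoulli w)) *
      (prodBernoulli w).real ({ω : BondConfig V | ∀ s ∈ S, ∀ t ∈ T, ¬ (openGraph ω).Reachable s t} ∩
        {ω | A (⋃ s ∈ S, openEdgeCluster ω s)}) ≤
    (∫ ω in {ω : BondConfig V | ∀ s ∈ S, ∀ t ∈ T, ¬ (openGraph ω).Reachable s t} ∩
          {ω | A (⋃ s ∈ S, openEdgeCluster ω s)}, G (⋃ s ∈ S, openEdgeCluster ω s) ∂(prodBernoulli w)) *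
      (prodBernoulli w).real ({ω : BondConfig V | ∀ s ∈ S, ∀ t ∈ T, ¬ (openGraph ω).Reachable s t} \
        {ω | A (⋃ s ∈ S, openEdgeCluster ω s)}) := by
  classical
  set μ := prodBernoulli w with hμ
  set D : Set (BondConfig V) := {ω : BondConfig V | ∀ s ∈ S, ∀ t ∈ T, ¬ (openGraph ω).Reachable s t} with hD
  set EA : Set (BondConfig V) := {ω | A (⋃ s ∈ S, openEdgeCluster ω s)} with hEA
  have hmeas : ∀ S' : Set (BondConfig V), MeasurableSet S' := fun _ => MeasurableSet.of_discrete
  have h := frame_event_assoc w S T G hG A hA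
  -- split `∫_D` and `μ D` along `E_A`
  have hI : ∫ ω in D ∩ EA, G (⋃ s ∈ S, openEdgeCluster ω s) ∂μ + ∫ ω in D \ EA, G (⋃ s ∈ S, openEdgeCluster ω s) ∂μ =
      ∫ ω in D, G (⋃ s ∈ S, openEdgeCluster ω s) ∂μ :=
    integral_inter_add_sdiff (hmeas EA) (Integrable.of_finite).integrableOn
  have hM : μ.real (D ∩ EA) + μ.real (D \ EA) = μ.real D := measureReal_inter_add_sdiff (hmeas EA)
  set IA := ∫ ω in D ∩ EA, G (⋃ s ∈ S, openEdgeCluster ω s) ∂μ with hIA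
  set IB := ∫ ω in D \ EA, G (⋃ s ∈ S, openEdgeCluster ω s) ∂μ with hIB
  set mA := μ.real (D ∩ EA) with hmA
  set mB := μ.real (D \ EA) with hmB
  -- h : (IA + IB) * mA ≤ (mA + mB) * IA
  rw [← hI, ← hM] at h
  nlinarith [h]

/-- **(D2)** — in the frame `S = {x,o}`, `T = Y ∪ {v}`: `law(C_S | x~o) ≽ law(C_S | x≁o)`; written out with the events of the (PS5)
frame, for every monotone `G` of the edge cluster of `{x,o}`:
`(∫_{OM} G)·μ(PM) ≥ (∫_{PM} G)·μ(OM)`, `OM = {S↮Y} ∩ {x~o} ∩ {x≁v}`, `PM = {S↮Y} ∩ {x≁o} ∩ {o≁v} ∩ {x≁v}`.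
[cite: VandenbergHaggstromKahn2005, Thm. 2.1 (p. 9)] [cite: KozmaNitzan2024, Question 8 (§5.5 p. 36)] -/
theorem frameDom_om_pm (w : Sym2 V → unitInterval) (x o v : V) (Y : Set V) (G : Set (Sym2 V) → ℝ) (hG : Monotone G) :
    (∫ ω in {ω : BondConfig V | ∀ s ∈ ({x, o} : Set V), ∀ t ∈ Y, ¬ (openGraph ω).Reachable s t} ∩
          {ω | ¬ (openGraph ω).Reachable x o} ∩ {ω | ¬ (openGraph ω).Reachable o v} ∩ {ω | ¬ (openGraph ω).Reachable x v},
        G (⋃ s ∈ ({x, o} : Set V), openEdgeCluster ω s) ∂(prodBernoulli w)) *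
      (prodBernoulli w).real ({ω : BondConfig V | ∀ s ∈ ({x, o} : Set V), ∀ t ∈ Y, ¬ (openGraph ω).Reachable s t} ∩
          openConn x o ∩ {ω | ¬ (openGraph ω).Reachable x v}) ≤
    (∫ ω in {ω : BondConfig V | ∀ s ∈ ({x, o} : Set V), ∀ t ∈ Y, ¬ (openGraph ω).Reachable s t} ∩
          openConn x o ∩ {ω | ¬ (openGraph ω).Reachable x v},
        G (⋃ s ∈ ({x, o} : Set V), openEdgeCluster ω s) ∂(prodBernoulli w)) *
      (prodBernoulli w).real ({ω : BondConfig V | ∀ s ∈ ({x, o} : Set V), ∀ t ∈ Y, ¬ (openGraph ω).Reachable s t} ∩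
          {ω | ¬ (openGraph ω).Reachable x o} ∩ {ω | ¬ (openGraph ω).Reachable o v} ∩ {ω | ¬ (openGraph ω).Reachable x v}) := by
  classical
  set S : Set V := {x, o} with hS
  set T : Set V := insert v Y with hT
  have hxS : x ∈ S := by simp [hS]
  set A : Set (Sym2 V) → Prop := fun C => (openGraph C).Reachable x o with hAdef
  have hA : ∀ C C' : Set (Sym2 V), C ⊆ C' → A C → A C' := fun C C' hCC' h => h.mono (openGraph_mono hCC')
  have h := frame_event_dom w S T G hG A hA
  set D : Set (BondConfig V) := {ω : BondConfig V | ∀ s ∈ S, ∀ t ∈ T, ¬ (openGraph ω).Reachable s t} with hD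
  set Fr : Set (BondConfig V) := {ω : BondConfig V | ∀ s ∈ ({x, o} : Set V), ∀ t ∈ Y, ¬ (openGraph ω).Reachable s t} with hFr
  have hEA : {ω : BondConfig V | A (⋃ s ∈ S, openEdgeCluster ω s)} = openConn x o := by
    ext ω
    simp only [hAdef, mem_setOf_eq, openConn]
    exact (KNSep.reachable_iff_cluster ω S hxS o).symm
  rw [hEA] at h
  -- identify `D ∩ {x~o}` and `D \ {x~o}`
  have e1 : D ∩ openConn x o = Fr ∩ openConn x o ∩ {ω | ¬ (openGraph ω).Reachable x v} := by
    ext ω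
    simp only [hD, hFr, hS, hT, mem_inter_iff, mem_setOf_eq, openConn, mem_insert_iff, mem_singleton_iff,
      forall_eq_or_imp, forall_eq]
    constructor
    · rintro ⟨⟨⟨hxv, hxY⟩, ⟨hov, hoY⟩⟩, hxo⟩
      exact ⟨⟨⟨hxY, hoY⟩, hxo⟩, hxv⟩
    · rintro ⟨⟨⟨hxY, hoY⟩, hxo⟩, hxv⟩
      exact ⟨⟨⟨hxv, hxY⟩, ⟨fun h => hxv (hxo.trans h), hoY⟩⟩, hxo⟩
  have e2 : D \ openConn x o = Fr ∩ {ω | ¬ (openGraph ω).Reachable x o} ∩ {ω | ¬ (openGraph ω).Reachable o v} ∩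
      {ω | ¬ (openGraph ω).Reachable x v} := by
    ext ω
    simp only [hD, hFr, hS, hT, mem_sdiff, mem_inter_iff, mem_setOf_eq, openConn, mem_insert_iff, mem_singleton_iff,
      forall_eq_or_imp, forall_eq]
    constructor
    · rintro ⟨⟨⟨hxv, hxY⟩, ⟨hov, hoY⟩⟩, hxo⟩
      exact ⟨⟨⟨⟨hxY, hoY⟩, hxo⟩, hov⟩, hxv⟩
    · rintro ⟨⟨⟨⟨hxY, hoY⟩, hxo⟩, hov⟩, hxv⟩
      exact ⟨⟨⟨hxv, hxY⟩, ⟨hov, hoY⟩⟩, hxo⟩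
  rw [e1, e2] at h
  exact h

/-- **(α)** — in the frame `S = {x,o}`, `T = Y`: `law(C_S | o ~ {x,v}) ≽ law(C_S | o ≁ x, o ≁ v)`; for every monotone `G`
of the edge cluster of `{x,o}`: `(∫_{Fr ∩ P} G)·μ(Fr ∩ O2) ≤ (∫_{Fr ∩ O2} G)·μ(Fr ∩ P)`, `O2 = {o~x} ∪ {o~v}`, `P = {o≁x} ∩ {o≁v}`.
[cite: VandenbergHaggstromKahn2005, Thm. 2.1 (p. 9)] [cite: KozmaNitzan2024, Question 8 (§5.5 p. 36)] -/
theorem frameDom_o2_p (w : Sym2 V → unitInterval) (x o v : V) (Y : Set V) (G : Set (Sym2 V) → ℝ) (hG : Monotone G) :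
    (∫ ω in {ω : BondConfig V | ∀ s ∈ ({x, o} : Set V), ∀ t ∈ Y, ¬ (openGraph ω).Reachable s t} ∩
          {ω | ¬ (openGraph ω).Reachable o x} ∩ {ω | ¬ (openGraph ω).Reachable o v},
        G (⋃ s ∈ ({x, o} : Set V), openEdgeCluster ω s) ∂(prodBernoulli w)) *
      (prodBernoulli w).real ({ω : BondConfig V | ∀ s ∈ ({x, o} : Set V), ∀ t ∈ Y, ¬ (openGraph ω).Reachable s t} ∩
          (openConn o x ∪ openConn o v)) ≤
    (∫ ω in {ω : BondConfig V | ∀ s ∈ ({x, o} : Set V), ∀ t ∈ Y, ¬ (openGraph ω).Reachable s t} ∩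
          (openConn o x ∪ openConn o v),
        G (⋃ s ∈ ({x, o} : Set V), openEdgeCluster ω s) ∂(prodBernoulli w)) *
      (prodBernoulli w).real ({ω : BondConfig V | ∀ s ∈ ({x, o} : Set V), ∀ t ∈ Y, ¬ (openGraph ω).Reachable s t} ∩
          {ω | ¬ (openGraph ω).Reachable o x} ∩ {ω | ¬ (openGraph ω).Reachable o v}) := by
  classical
  set S : Set V := {x, o} with hS
  have hoS : o ∈ S := by simp [hS]
  set A : Set (Sym2 V) → Prop := fun C => (openGraph C).Reachable o x ∨ (openGraph C).Reachable o v with hAdef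
  have hA : ∀ C C' : Set (Sym2 V), C ⊆ C' → A C → A C' := by
    rintro C C' hCC' (h | h)
    · exact Or.inl (h.mono (openGraph_mono hCC'))
    · exact Or.inr (h.mono (openGraph_mono hCC'))
  have h := frame_event_dom w S Y G hG A hA
  set D : Set (BondConfig V) := {ω : BondConfig V | ∀ s ∈ S, ∀ t ∈ Y, ¬ (openGraph ω).Reachable s t} with hD
  have hEA : {ω : BondConfig V | A (⋃ s ∈ S, openEdgeCluster ω s)} = openConn o x ∪ openConn o v := by
    ext ω
    simp only [hAdef, mem_setOf_eq, mem_union, openConn]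
    rw [← KNSep.reachable_iff_cluster ω S hoS x, ← KNSep.reachable_iff_cluster ω S hoS v]
  rw [hEA] at h
  have e2 : D \ (openConn o x ∪ openConn o v) = D ∩ {ω | ¬ (openGraph ω).Reachable o x} ∩ {ω | ¬ (openGraph ω).Reachable o v} := by
    ext ω
    simp only [mem_sdiff, mem_inter_iff, mem_union, mem_setOf_eq, openConn, not_or]
    constructor
    · rintro ⟨hd, hox, hov⟩
      exact ⟨⟨hd, hox⟩, hov⟩
    · rintro ⟨⟨hd, hox⟩, hov⟩
      exact ⟨hd, hox, hov⟩
  rw [e2] at h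
  exact h

/-- **(ε)** — in the frame `S = {x,o}`, `T = Y`, for `G ≥ 0` monotone: `Cov'(G·1{x~v}, 1{o~{x,v}}) ≥ 0`, i.e.
`(∫_{Fr ∩ {x~v}} G)·μ(Fr ∩ ({o~x} ∪ {o~v})) ≤ μ(Fr)·∫_{Fr ∩ {x~v} ∩ {x~o}} G`.  With `G = 1` this is the mass inequality (c4′).
[cite: VandenbergHaggstromKahn2005, Thm. 2.1 (p. 9)] [cite: KozmaNitzan2024, Question 8 (§5.5 p. 36)] -/
theorem frameCov_ov_o2 (w : Sym2 V → unitInterval) (x o v : V) (Y : Set V) (G : Set (Sym2 V) → ℝ) (hG : Monotone G)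
    (hG0 : ∀ C, 0 ≤ G C) :
    (∫ ω in {ω : BondConfig V | ∀ s ∈ ({x, o} : Set V), ∀ t ∈ Y, ¬ (openGraph ω).Reachable s t} ∩ openConn x v,
        G (⋃ s ∈ ({x, o} : Set V), openEdgeCluster ω s) ∂(prodBernoulli w)) *
      (prodBernoulli w).real ({ω : BondConfig V | ∀ s ∈ ({x, o} : Set V), ∀ t ∈ Y, ¬ (openGraph ω).Reachable s t} ∩
          (openConn o x ∪ openConn o v)) ≤
    (prodBernoulli w).real {ω : BondConfig V | ∀ s ∈ ({x, o} : Set V), ∀ t ∈ Y, ¬ (openGraph ω).Reachable s t} *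
      ∫ ω in {ω : BondConfig V | ∀ s ∈ ({x, o} : Set V), ∀ t ∈ Y, ¬ (openGraph ω).Reachable s t} ∩ openConn x v ∩ openConn x o,
        G (⋃ s ∈ ({x, o} : Set V), openEdgeCluster ω s) ∂(prodBernoulli w) := by
  classical
  set μ := prodBernoulli w with hμ
  set S : Set V := {x, o} with hS
  have hxS : x ∈ S := by simp [hS]
  have hoS : o ∈ S := by simp [hS]
  set D : Set (BondConfig V) := {ω : BondConfig V | ∀ s ∈ S, ∀ t ∈ Y, ¬ (openGraph ω).Reachable s t} with hD
  have hmeas : ∀ S' : Set (BondConfig V), MeasurableSet S' := fun _ => MeasurableSet.of_discrete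
  -- the two increasing functions of `C_S`
  set F1 : Set (Sym2 V) → ℝ := fun C => if (openGraph C).Reachable x v then G C else 0 with hF1
  set F2 : Set (Sym2 V) → ℝ := fun C => if (openGraph C).Reachable o x ∨ (openGraph C).Reachable o v then 1 else 0 with hF2
  have hF1_mono : Monotone F1 := by
    intro C C' hCC'
    simp only [hF1]
    by_cases h : (openGraph C).Reachable x v
    · rw [if_pos h, if_pos (h.mono (openGraph_mono hCC'))]; exact hG hCC'
    · rw [if_neg h]; split_ifs
      · exact hG0 _
      · exact le_rfl
  have hF2_mono : Monotone F2 := by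
    intro C C' hCC'
    simp only [hF2]
    by_cases h : (openGraph C).Reachable o x ∨ (openGraph C).Reachable o v
    · have h' : (openGraph C').Reachable o x ∨ (openGraph C').Reachable o v := by
        rcases h with h | h
        · exact Or.inl (h.mono (openGraph_mono hCC'))
        · exact Or.inr (h.mono (openGraph_mono hCC'))
      rw [if_pos h, if_pos h']
    · rw [if_neg h]; split_ifs <;> norm_num
  have h := BHK2006_twoSetConditionalAssociation w S Y (fun C _ => F1 C) (fun C _ => F2 C)
    (fun _ => hF1_mono) (fun _ => antitone_const) (fun _ => hF2_mono) (fun _ => antitone_const)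
  -- identify the three integrands as indicators of events of `ω`
  set EV : Set (BondConfig V) := openConn x v with hEV
  set E2 : Set (BondConfig V) := openConn o x ∪ openConn o v with hE2
  have hF1_eq : ∀ ω : BondConfig V, F1 (⋃ s ∈ S, openEdgeCluster ω s) = EV.indicator (fun ω => G (⋃ s ∈ S, openEdgeCluster ω s)) ω := by
    intro ω
    simp only [hF1]
    rw [← KNSep.reachable_iff_cluster ω S hxS v]
    by_cases hω : (openGraph ω).Reachable x v
    · rw [if_pos hω, indicator_of_mem (show ω ∈ EV from hω)]
    · rw [if_neg hω, indicator_of_notMem (show ω ∉ EV from hω)]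
  have hF2_eq : ∀ ω : BondConfig V, F2 (⋃ s ∈ S, openEdgeCluster ω s) = E2.indicator (1 : BondConfig V → ℝ) ω := by
    intro ω
    simp only [hF2]
    rw [← KNSep.reachable_iff_cluster ω S hoS x, ← KNSep.reachable_iff_cluster ω S hoS v]
    by_cases hω : (openGraph ω).Reachable o x ∨ (openGraph ω).Reachable o v
    · rw [if_pos hω, indicator_of_mem (show ω ∈ E2 from hω), Pi.one_apply]
    · rw [if_neg hω, indicator_of_notMem (show ω ∉ E2 from hω)]
  have i1 : ∫ ω in D, F1 (⋃ s ∈ S, openEdgeCluster ω s) ∂μ = ∫ ω in D ∩ EV, G (⋃ s ∈ S, openEdgeCluster ω s) ∂μ := by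
    rw [integral_congr_ae (Filter.Eventually.of_forall fun ω => hF1_eq ω)]
    exact setIntegral_indicator (hmeas EV)
  have i2 : ∫ ω in D, F2 (⋃ s ∈ S, openEdgeCluster ω s) ∂μ = μ.real (D ∩ E2) := by
    rw [integral_congr_ae (Filter.Eventually.of_forall fun ω => hF2_eq ω)]
    exact setIntegral_indicator_one_eq μ D E2
  have hprod : ∀ ω : BondConfig V, F1 (⋃ s ∈ S, openEdgeCluster ω s) * F2 (⋃ s ∈ S, openEdgeCluster ω s) =
      (EV ∩ openConn x o).indicator (fun ω => G (⋃ s ∈ S, openEdgeCluster ω s)) ω := by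
    intro ω
    rw [hF1_eq ω, hF2_eq ω]
    by_cases hv : ω ∈ EV
    · by_cases h2 : ω ∈ E2
      · have hxo : ω ∈ EV ∩ openConn x o := by
          refine ⟨hv, ?_⟩
          rcases h2 with h | h
          · exact SimpleGraph.Reachable.symm h
          · exact (show (openGraph ω).Reachable x v from hv).trans (SimpleGraph.Reachable.symm h)
        rw [indicator_of_mem hv, indicator_of_mem h2, indicator_of_mem hxo, Pi.one_apply, mul_one]
      · have hxo : ω ∉ EV ∩ openConn x o := fun h => h2 (Or.inl (SimpleGraph.Reachable.symm h.2))
        rw [indicator_of_notMem h2, indicator_of_notMem hxo, mul_zero]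
    · rw [indicator_of_notMem hv, indicator_of_notMem (show ω ∉ EV ∩ openConn x o from fun h => hv h.1), zero_mul]
  have i3 : ∫ ω in D, F1 (⋃ s ∈ S, openEdgeCluster ω s) * F2 (⋃ s ∈ S, openEdgeCluster ω s) ∂μ =
      ∫ ω in D ∩ EV ∩ openConn x o, G (⋃ s ∈ S, openEdgeCluster ω s) ∂μ := by
    rw [integral_congr_ae (Filter.Eventually.of_forall fun ω => hprod ω), setIntegral_indicator (hmeas _), inter_assoc]
  rw [i1, i2, i3] at h
  exact h

end PocketCert

end

end Summit.CriticalPhenomena.PercolationContinuityZ3.Theorems
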